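import Summits.CriticalPhenomena.PercolationContinuityZ3.Theorems.PercNearOneGluingNoHeavyLowerTailSunflowerSpectatorTransferOrPetalPair
import HarnessLib
import HarnessLib.Audit

/-!
# `NoHeavyLowerTail` (crux stmt-CriticalPhenomena-4575), abstract sunflower cubic: the spectator-transfer inequality (♣) behind a
# THREE-point disjunctive petal

Support file (seat `prim-ineq-gen-2` gen 22; `--supports stmt-CriticalPhenomena-4575`).  No `sorry`, no named facts.  Same method as
`…SunflowerSpectatorTransferOrPetalPair` (two points): expand the ordered 3-partitions of `α` by the blocks receiving `s, t, u`
(`nested_insert_split`, 1 + 3 + 9 times), so that `Q = SA + SB + 2·Nkk 3 − 2·Nabk 3` becomes a nested sum over the 3-partitions of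
`E' = univ ∖ {s,t,u}` of a 27-placement kernel `ker27` of the BLOCK DATA (the eight labels `lab (X ∪ σ)`, `σ ⊆ {s,t,u}`); subtract the spectator
rows `rowW3 (X) · Σ_S kk` (antipodal Gladkov, `≥ 0`) of the set `𝒯₃` = "marked, or bottom with `X ∪ {s,t,u}` the only kernel lift"; behind
`IsOrPetal {s,t,u}` the block data takes 22 values (`blockCode3`; 3 marked + the 19 monotone `3/4`-patterns), and the symmetrised difference kernel is
`≥ 0` on all `22³` code triples (`ker27_symm_nonneg`, 22 `decide` chunks).  Memo: SPECTATOR-TRANSFER-GEN22.md §8b; generator gen22/gen_r3.py.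
-/

namespace Summit.CriticalPhenomena.PercolationContinuityZ3.Theorems.SunflowerPartition

open Finset

/-! ## Finite kernels (generated by gen22/gen_r3.py) -/

/-- Block data for three points: the labels of `X ∪ σ`, `σ ⊆ {s,t,u}`, indexed by the bitmask of `σ` (`s`=1, `t`=2, `u`=4). [this work] -/
abbrev BlockData3 := Fin 5 × Fin 5 × Fin 5 × Fin 5 × Fin 5 × Fin 5 × Fin 5 × Fin 5

/-- Weight of the spectator row of a first block with data `a` (the set `𝒯₃`): marked, or bottom with `X ∪ {s,t,u}` the only kernel lift. [this work] -/
def rowW3 (a : BlockData3) : ℤ :=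
  if a.1 ≠ 0 ∨ (a.2.1 = 3 ∧ a.2.2.1 = 3 ∧ a.2.2.2.1 = 3 ∧ a.2.2.2.2.1 = 3 ∧ a.2.2.2.2.2.1 = 3 ∧ a.2.2.2.2.2.2.1 = 3 ∧ a.2.2.2.2.2.2.2 = 4) then 1 else 0

/-- `rowW3 ≥ 0`. [this work] -/
theorem rowW3_nonneg (a : BlockData3) : 0 ≤ rowW3 a := by
  unfold rowW3; split_ifs <;> norm_num

/-- The 27 placements of `s,t,u` into the blocks, minus the spectator row of the first block. [this work] -/
def ker27 (a b c : BlockData3) : ℤ :=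
    clubKer a.2.2.2.2.2.2.2 b.1 c.1
    + clubKer a.2.2.2.1 b.2.2.2.2.1 c.1
    + clubKer a.2.2.2.1 b.1 c.2.2.2.2.1
    + clubKer a.2.2.2.2.2.1 b.2.2.1 c.1
    + clubKer a.2.1 b.2.2.2.2.2.2.1 c.1
    + clubKer a.2.1 b.2.2.1 c.2.2.2.2.1
    + clubKer a.2.2.2.2.2.1 b.1 c.2.2.1
    + clubKer a.2.1 b.2.2.2.2.1 c.2.2.1
    + clubKer a.2.1 b.1 c.2.2.2.2.2.2.1
    + clubKer a.2.2.2.2.2.2.1 b.2.1 c.1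
    + clubKer a.2.2.1 b.2.2.2.2.2.1 c.1
    + clubKer a.2.2.1 b.2.1 c.2.2.2.2.1
    + clubKer a.2.2.2.2.1 b.2.2.2.1 c.1
    + clubKer a.1 b.2.2.2.2.2.2.2 c.1
    + clubKer a.1 b.2.2.2.1 c.2.2.2.2.1
    + clubKer a.2.2.2.2.1 b.2.1 c.2.2.1
    + clubKer a.1 b.2.2.2.2.2.1 c.2.2.1
    + clubKer a.1 b.2.1 c.2.2.2.2.2.2.1
    + clubKer a.2.2.2.2.2.2.1 b.1 c.2.1
    + clubKer a.2.2.1 b.2.2.2.2.1 c.2.1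
    + clubKer a.2.2.1 b.1 c.2.2.2.2.2.1
    + clubKer a.2.2.2.2.1 b.2.2.1 c.2.1
    + clubKer a.1 b.2.2.2.2.2.2.1 c.2.1
    + clubKer a.1 b.2.2.1 c.2.2.2.2.2.1
    + clubKer a.2.2.2.2.1 b.1 c.2.2.2.1
    + clubKer a.1 b.2.2.2.2.1 c.2.2.2.1
    + clubKer a.1 b.1 c.2.2.2.2.2.2.2
    - rowW3 a * kk b.1 c.1

/-- The 22 block-data values behind a three-point disjunctive petal. [this work] -/
def blockCode3 : Fin 22 → BlockData3 :=
  ![(1, 4, 4, 4, 4, 4, 4, 4),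
    (2, 4, 4, 4, 4, 4, 4, 4),
    (4, 4, 4, 4, 4, 4, 4, 4),
    (0, 3, 3, 3, 3, 3, 3, 3),
    (0, 3, 3, 3, 3, 3, 3, 4),
    (0, 3, 3, 4, 3, 3, 3, 4),
    (0, 3, 3, 3, 3, 4, 3, 4),
    (0, 3, 3, 4, 3, 4, 3, 4),
    (0, 4, 3, 4, 3, 4, 3, 4),
    (0, 3, 3, 3, 3, 3, 4, 4),
    (0, 3, 3, 4, 3, 3, 4, 4),
    (0, 3, 4, 4, 3, 3, 4, 4),
    (0, 3, 3, 3, 3, 4, 4, 4),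
    (0, 3, 3, 4, 3, 4, 4, 4),
    (0, 4, 3, 4, 3, 4, 4, 4),
    (0, 3, 4, 4, 3, 4, 4, 4),
    (0, 4, 4, 4, 3, 4, 4, 4),
    (0, 3, 3, 3, 4, 4, 4, 4),
    (0, 3, 3, 4, 4, 4, 4, 4),
    (0, 4, 3, 4, 4, 4, 4, 4),
    (0, 3, 4, 4, 4, 4, 4, 4),
    (0, 4, 4, 4, 4, 4, 4, 4)]

/-- Kernel check, first code `0`. [this work] -/
theorem ker27_symm_nonneg_0 : ∀ b c : Fin 22, 0 ≤ symm6Of ker27 (blockCode3 0) (blockCode3 b) (blockCode3 c) := by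
  decide

/-- Kernel check, first code `1`. [this work] -/
theorem ker27_symm_nonneg_1 : ∀ b c : Fin 22, 0 ≤ symm6Of ker27 (blockCode3 1) (blockCode3 b) (blockCode3 c) := by
  decide

/-- Kernel check, first code `2`. [this work] -/
theorem ker27_symm_nonneg_2 : ∀ b c : Fin 22, 0 ≤ symm6Of ker27 (blockCode3 2) (blockCode3 b) (blockCode3 c) := by
  decide

/-- Kernel check, first code `3`. [this work] -/
theorem ker27_symm_nonneg_3 : ∀ b c : Fin 22, 0 ≤ symm6Of ker27 (blockCode3 3) (blockCode3 b) (blockCode3 c) := by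
  decide

/-- Kernel check, first code `4`. [this work] -/
theorem ker27_symm_nonneg_4 : ∀ b c : Fin 22, 0 ≤ symm6Of ker27 (blockCode3 4) (blockCode3 b) (blockCode3 c) := by
  decide

/-- Kernel check, first code `5`. [this work] -/
theorem ker27_symm_nonneg_5 : ∀ b c : Fin 22, 0 ≤ symm6Of ker27 (blockCode3 5) (blockCode3 b) (blockCode3 c) := by
  decide

/-- Kernel check, first code `6`. [this work] -/
theorem ker27_symm_nonneg_6 : ∀ b c : Fin 22, 0 ≤ symm6Of ker27 (blockCode3 6) (blockCode3 b) (blockCode3 c) := by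
  decide

/-- Kernel check, first code `7`. [this work] -/
theorem ker27_symm_nonneg_7 : ∀ b c : Fin 22, 0 ≤ symm6Of ker27 (blockCode3 7) (blockCode3 b) (blockCode3 c) := by
  decide

/-- Kernel check, first code `8`. [this work] -/
theorem ker27_symm_nonneg_8 : ∀ b c : Fin 22, 0 ≤ symm6Of ker27 (blockCode3 8) (blockCode3 b) (blockCode3 c) := by
  decide

/-- Kernel check, first code `9`. [this work] -/
theorem ker27_symm_nonneg_9 : ∀ b c : Fin 22, 0 ≤ symm6Of ker27 (blockCode3 9) (blockCode3 b) (blockCode3 c) := by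
  decide

/-- Kernel check, first code `10`. [this work] -/
theorem ker27_symm_nonneg_10 : ∀ b c : Fin 22, 0 ≤ symm6Of ker27 (blockCode3 10) (blockCode3 b) (blockCode3 c) := by
  decide

/-- Kernel check, first code `11`. [this work] -/
theorem ker27_symm_nonneg_11 : ∀ b c : Fin 22, 0 ≤ symm6Of ker27 (blockCode3 11) (blockCode3 b) (blockCode3 c) := by
  decide

/-- Kernel check, first code `12`. [this work] -/
theorem ker27_symm_nonneg_12 : ∀ b c : Fin 22, 0 ≤ symm6Of ker27 (blockCode3 12) (blockCode3 b) (blockCode3 c) := by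
  decide

/-- Kernel check, first code `13`. [this work] -/
theorem ker27_symm_nonneg_13 : ∀ b c : Fin 22, 0 ≤ symm6Of ker27 (blockCode3 13) (blockCode3 b) (blockCode3 c) := by
  decide

/-- Kernel check, first code `14`. [this work] -/
theorem ker27_symm_nonneg_14 : ∀ b c : Fin 22, 0 ≤ symm6Of ker27 (blockCode3 14) (blockCode3 b) (blockCode3 c) := by
  decide

/-- Kernel check, first code `15`. [this work] -/
theorem ker27_symm_nonneg_15 : ∀ b c : Fin 22, 0 ≤ symm6Of ker27 (blockCode3 15) (blockCode3 b) (blockCode3 c) := by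
  decide

/-- Kernel check, first code `16`. [this work] -/
theorem ker27_symm_nonneg_16 : ∀ b c : Fin 22, 0 ≤ symm6Of ker27 (blockCode3 16) (blockCode3 b) (blockCode3 c) := by
  decide

/-- Kernel check, first code `17`. [this work] -/
theorem ker27_symm_nonneg_17 : ∀ b c : Fin 22, 0 ≤ symm6Of ker27 (blockCode3 17) (blockCode3 b) (blockCode3 c) := by
  decide

/-- Kernel check, first code `18`. [this work] -/
theorem ker27_symm_nonneg_18 : ∀ b c : Fin 22, 0 ≤ symm6Of ker27 (blockCode3 18) (blockCode3 b) (blockCode3 c) := by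
  decide

/-- Kernel check, first code `19`. [this work] -/
theorem ker27_symm_nonneg_19 : ∀ b c : Fin 22, 0 ≤ symm6Of ker27 (blockCode3 19) (blockCode3 b) (blockCode3 c) := by
  decide

/-- Kernel check, first code `20`. [this work] -/
theorem ker27_symm_nonneg_20 : ∀ b c : Fin 22, 0 ≤ symm6Of ker27 (blockCode3 20) (blockCode3 b) (blockCode3 c) := by
  decide

/-- Kernel check, first code `21`. [this work] -/
theorem ker27_symm_nonneg_21 : ∀ b c : Fin 22, 0 ≤ symm6Of ker27 (blockCode3 21) (blockCode3 b) (blockCode3 c) := by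
  decide

/-- **Finite kernel check** (all 22³ code triples). [this work] -/
theorem ker27_symm_nonneg : ∀ a b c : Fin 22, 0 ≤ symm6Of ker27 (blockCode3 a) (blockCode3 b) (blockCode3 c) := by
  intro a
  fin_cases a
  · exact ker27_symm_nonneg_0
  · exact ker27_symm_nonneg_1
  · exact ker27_symm_nonneg_2
  · exact ker27_symm_nonneg_3
  · exact ker27_symm_nonneg_4
  · exact ker27_symm_nonneg_5
  · exact ker27_symm_nonneg_6
  · exact ker27_symm_nonneg_7
  · exact ker27_symm_nonneg_8
  · exact ker27_symm_nonneg_9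
  · exact ker27_symm_nonneg_10
  · exact ker27_symm_nonneg_11
  · exact ker27_symm_nonneg_12
  · exact ker27_symm_nonneg_13
  · exact ker27_symm_nonneg_14
  · exact ker27_symm_nonneg_15
  · exact ker27_symm_nonneg_16
  · exact ker27_symm_nonneg_17
  · exact ker27_symm_nonneg_18
  · exact ker27_symm_nonneg_19
  · exact ker27_symm_nonneg_20
  · exact ker27_symm_nonneg_21

/-- `3`/`4` from a Boolean. [this work] -/
def lab34 (b : Bool) : Fin 5 := if b then 4 else 3

/-- Monotonicity of a `3/4` pattern on the seven nonempty offsets along the nine covering pairs of `2^{s,t,u}`, as a Boolean test. [this work] -/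
def mono7 (b1 b2 b3 b4 b5 b6 b7 : Bool) : Bool :=
  (!b1 || b3) && (!b1 || b5) && (!b2 || b3) && (!b2 || b6) && (!b3 || b7) && (!b4 || b5) && (!b4 || b6) && (!b5 || b7) && (!b6 || b7)

-- The equality test on the eight-fold product needs a slightly larger instance-search budget than the default.
set_option synthInstance.maxHeartbeats 200000 in
set_option synthInstance.maxSize 2048 in
/-- Bottom blocks: every monotone `3/4` pattern on the seven nonempty offsets is one of the codes `3..21`. [this work] -/
theorem exists_blockCode3_zero : ∀ b1 b2 b3 b4 b5 b6 b7 : Bool, mono7 b1 b2 b3 b4 b5 b6 b7 = true →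
    ∃ c : Fin 22, blockCode3 c = (0, lab34 b1, lab34 b2, lab34 b3, lab34 b4, lab34 b5, lab34 b6, lab34 b7) := by
  decide

set_option synthInstance.maxHeartbeats 200000 in
set_option synthInstance.maxSize 2048 in
/-- Marked blocks: `(ℓ,4,…,4)` with `ℓ ∈ {1,2,4}` is one of the codes `0..2`. [this work] -/
theorem exists_blockCode3_marked : ∀ l : Fin 5, (l = 1 ∨ l = 2 ∨ l = 4) → ∃ c : Fin 22, blockCode3 c = (l, 4, 4, 4, 4, 4, 4, 4) := by
  decide

/-! ## The theorem -/

variable {α : Type*} [DecidableEq α]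

namespace Sunflower

variable (F : Sunflower α)

/-- The block data of `X` relative to `s, t, u`. [this work] -/
def blockData3 (s t u : α) (X : Finset α) : BlockData3 :=
  (F.lab X, F.lab (insert s X), F.lab (insert t X), F.lab (insert s (insert t X)), F.lab (insert u X), F.lab (insert s (insert u X)), F.lab (insert t (insert u X)), F.lab (insert s (insert t (insert u X))))

/-- A lifted label equal to its lower neighbour or `4`: if the lower one is `4` so is the upper one. [this work] -/
theorem lab34_mono_aux : ∀ x y : Fin 5, (x = 3 ∨ x = 4) → (y = 3 ∨ y = 4) → (x = y ∨ x = 0 ∨ y = 4) →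
    ((decide (x = 4)) = true → (decide (y = 4)) = true) := by decide

/-- `lab34 (decide (x = 4)) = x` for `x ∈ {3,4}`. [this work] -/
theorem lab34_decide : ∀ x : Fin 5, (x = 3 ∨ x = 4) → lab34 (decide (x = 4)) = x := by decide

/-- Behind a three-point disjunctive petal, the block data of a set avoiding `s,t,u` is one of the 22 codes. [this work] -/
theorem exists_blockCode3 {s t u : α} (h : F.IsOrPetal {s, t, u}) {X : Finset α} (hs : s ∉ X) (ht : t ∉ X) (hu : u ∉ X) :
    ∃ c : Fin 22, blockCode3 c = F.blockData3 s t u X := by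
  unfold blockData3
  have h34 : ∀ Y : Finset α, (Y ∩ {s, t, u}).Nonempty → F.lab Y = 3 ∨ F.lab Y = 4 := h.2.1
  have ms : s ∈ ({s, t, u} : Finset α) := by simp
  have mt : t ∈ ({s, t, u} : Finset α) := by simp
  have mu : u ∈ ({s, t, u} : Finset α) := by simp
  -- the seven lifted labels are 3 or 4
  have n1 : F.lab (insert s X) = 3 ∨ F.lab (insert s X) = 4 := h34 _ ⟨s, mem_inter.2 ⟨mem_insert_self _ _, ms⟩⟩
  have n2 : F.lab (insert t X) = 3 ∨ F.lab (insert t X) = 4 := h34 _ ⟨t, mem_inter.2 ⟨mem_insert_self _ _, mt⟩⟩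
  have n3 : F.lab (insert s (insert t X)) = 3 ∨ F.lab (insert s (insert t X)) = 4 :=
    h34 _ ⟨s, mem_inter.2 ⟨mem_insert_self _ _, ms⟩⟩
  have n4 : F.lab (insert u X) = 3 ∨ F.lab (insert u X) = 4 := h34 _ ⟨u, mem_inter.2 ⟨mem_insert_self _ _, mu⟩⟩
  have n5 : F.lab (insert s (insert u X)) = 3 ∨ F.lab (insert s (insert u X)) = 4 :=
    h34 _ ⟨s, mem_inter.2 ⟨mem_insert_self _ _, ms⟩⟩
  have n6 : F.lab (insert t (insert u X)) = 3 ∨ F.lab (insert t (insert u X)) = 4 :=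
    h34 _ ⟨t, mem_inter.2 ⟨mem_insert_self _ _, mt⟩⟩
  have n7 : F.lab (insert s (insert t (insert u X))) = 3 ∨ F.lab (insert s (insert t (insert u X))) = 4 :=
    h34 _ ⟨s, mem_inter.2 ⟨mem_insert_self _ _, ms⟩⟩
  have x3 : F.lab X ≠ 3 := by
    intro h3
    obtain ⟨x, hx⟩ := h.2.2 X h3
    rw [mem_inter] at hx
    simp only [mem_insert, mem_singleton] at hx
    rcases hx.2 with rfl | rfl | rfl
    · exact hs hx.1
    · exact ht hx.1
    · exact hu hx.1
  by_cases h0 : F.lab X = 0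
  · -- bottom block: encode the seven lifted labels by Booleans
    rw [h0]
    have M := fun (x y : Fin 5) (hx : x = 3 ∨ x = 4) (hy : y = 3 ∨ y = 4) (hxy : x = y ∨ x = 0 ∨ y = 4) => lab34_mono_aux x y hx hy hxy
    obtain ⟨c, hc⟩ := exists_blockCode3_zero (decide (F.lab (insert s X) = 4)) (decide (F.lab (insert t X) = 4))
      (decide (F.lab (insert s (insert t X)) = 4)) (decide (F.lab (insert u X) = 4)) (decide (F.lab (insert s (insert u X)) = 4))
      (decide (F.lab (insert t (insert u X)) = 4)) (decide (F.lab (insert s (insert t (insert u X))) = 4)) (by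
        have i1 := M _ _ n1 n3 (F.lab_mono (insert_subset_insert s (subset_insert t X)))
        have i2 := M _ _ n1 n5 (F.lab_mono (insert_subset_insert s (subset_insert u X)))
        have i3 := M _ _ n2 n3 (F.lab_mono (subset_insert s (insert t X)))
        have i4 := M _ _ n2 n6 (F.lab_mono (insert_subset_insert t (subset_insert u X)))
        have i5 := M _ _ n3 n7 (F.lab_mono (insert_subset_insert s (insert_subset_insert t (subset_insert u X))))
        have i6 := M _ _ n4 n5 (F.lab_mono (subset_insert s (insert u X)))
        have i7 := M _ _ n4 n6 (F.lab_mono (subset_insert t (insert u X)))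
        have i8 := M _ _ n5 n7 (F.lab_mono (insert_subset_insert s (subset_insert t (insert u X))))
        have i9 := M _ _ n6 n7 (F.lab_mono (subset_insert s (insert t (insert u X))))
        revert i1 i2 i3 i4 i5 i6 i7 i8 i9
        generalize decide (F.lab (insert s X) = 4) = b1
        generalize decide (F.lab (insert t X) = 4) = b2
        generalize decide (F.lab (insert s (insert t X)) = 4) = b3
        generalize decide (F.lab (insert u X) = 4) = b4
        generalize decide (F.lab (insert s (insert u X)) = 4) = b5
        generalize decide (F.lab (insert t (insert u X)) = 4) = b6
        generalize decide (F.lab (insert s (insert t (insert u X))) = 4) = b7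
        revert b1 b2 b3 b4 b5 b6 b7
        decide)
    refine ⟨c, ?_⟩
    rw [hc, lab34_decide _ n1, lab34_decide _ n2, lab34_decide _ n3, lab34_decide _ n4, lab34_decide _ n5, lab34_decide _ n6,
      lab34_decide _ n7]
  · -- marked block: all lifts are kernel
    have hm : F.lab X = 1 ∨ F.lab X = 2 ∨ F.lab X = 4 := by
      have := F.lab X; revert x3 h0; generalize F.lab X = v; revert v; decide
    have lift : ∀ Y : Finset α, X ⊆ Y → (F.lab Y = 3 ∨ F.lab Y = 4) → F.lab Y = 4 := fun Y hXY hY => by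
      rcases F.lab_mono hXY with e | e | e
      · rcases hY with e3 | e4
        · exact absurd (e.trans e3) x3
        · exact e4
      · exact absurd e h0
      · exact e
    have sX : X ⊆ insert s X := subset_insert s X
    have tX : X ⊆ insert t X := subset_insert t X
    have uX : X ⊆ insert u X := subset_insert u X
    rw [lift _ sX n1, lift _ tX n2, lift _ (tX.trans (subset_insert s _)) n3, lift _ uX n4, lift _ (uX.trans (subset_insert s _)) n5,
      lift _ (uX.trans (subset_insert t _)) n6, lift _ ((uX.trans (subset_insert t _)).trans (subset_insert s _)) n7]
    exact exists_blockCode3_marked _ hm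

/-- **(♣) behind a three-point disjunctive petal**: if the petal `3` is exactly the family of non-kernel sets meeting `{s,t,u}`
(`s,t,u` distinct), then `2·Nabk 3 ≤ SA + SB + 2·Nkk 3`. [this work] -/
theorem spectatorTransfer_three_of_isOrPetal_triple [Fintype α] {s t u : α} (hst : s ≠ t) (hsu : s ≠ u) (htu : t ≠ u)
    (h : F.IsOrPetal {s, t, u}) : 2 * F.Nabk 3 ≤ F.SA + F.SB + 2 * F.Nkk 3 := by
  set E' : Finset α := univ \ {s, t, u} with hE'
  have hsE : s ∉ E' := fun hh => (mem_sdiff.1 hh).2 (by simp)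
  have htE : t ∉ E' := fun hh => (mem_sdiff.1 hh).2 (by simp)
  have huE : u ∉ E' := fun hh => (mem_sdiff.1 hh).2 (by simp)
  have htW : t ∉ insert u E' := fun hh => by
    rcases mem_insert.1 hh with hh | hh
    · exact htu hh
    · exact htE hh
  have hsW : s ∉ insert t (insert u E') := fun hh => by
    rcases mem_insert.1 hh with hh | hh
    · exact hst hh
    rcases mem_insert.1 hh with hh | hh
    · exact hsu hh
    · exact hsE hh
  have huniv : (univ : Finset α) = insert s (insert t (insert u E')) := by
    ext x
    simp only [mem_univ, mem_insert, hE', mem_sdiff, mem_singleton, true_and, true_iff]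
    tauto
  set G : Finset α → Finset α → Finset α → ℤ := fun X S T => clubKer (F.lab X) (F.lab S) (F.lab T) with hG
  set L : Finset α → BlockData3 := F.blockData3 s t u with hL
  have hsplit : nested (insert s (insert t (insert u E'))) G
      = nested E' (fun X S T => ker27 (L X) (L S) (L T)) + nested E' (fun X S T => rowW3 (L X) * kk (F.lab S) (F.lab T)) := by
    rw [nested_insert_split _ s hsW]
    rw [nested_insert_split _ t htW, nested_insert_split _ t htW, nested_insert_split _ t htW]
    rw [nested_insert_split _ u huE, nested_insert_split _ u huE, nested_insert_split _ u huE, nested_insert_split _ u huE,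
      nested_insert_split _ u huE, nested_insert_split _ u huE, nested_insert_split _ u huE, nested_insert_split _ u huE,
      nested_insert_split _ u huE]
    unfold nested
    simp only [hG, hL, blockData3, ker27, sum_add_distrib, sum_sub_distrib]
    ring
  have hker : 0 ≤ nested E' (fun X S T => ker27 (L X) (L S) (L T)) := by
    have h6 := six_mul_nested_eq_symm6Of E' L ker27
    have hpos : 0 ≤ nested E' (fun X S T => symm6Of ker27 (L X) (L S) (L T)) := by
      refine nested_nonneg_of_forall E' _ fun X hX S hS => ?_
      have hT : (E' \ X) \ S ⊆ E' := sdiff_subset.trans sdiff_subset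
      have hS' : S ⊆ E' := hS.trans sdiff_subset
      obtain ⟨a, ha⟩ := F.exists_blockCode3 h (fun hh => hsE (hX hh)) (fun hh => htE (hX hh)) (fun hh => huE (hX hh))
      obtain ⟨b, hb⟩ := F.exists_blockCode3 h (fun hh => hsE (hS' hh)) (fun hh => htE (hS' hh)) (fun hh => huE (hS' hh))
      obtain ⟨c, hc⟩ := F.exists_blockCode3 h (fun hh => hsE (hT hh)) (fun hh => htE (hT hh)) (fun hh => huE (hT hh))
      rw [hL, ← ha, ← hb, ← hc]
      exact ker27_symm_nonneg a b c
    linarith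
  have hrows : 0 ≤ nested E' (fun X S T => rowW3 (L X) * kk (F.lab S) (F.lab T)) :=
    F.nested_weight_mul_kk_nonneg E' (fun X => rowW3 (L X)) fun X => rowW3_nonneg _
  have hQ : F.SA + F.SB + 2 * F.Nkk 3 - 2 * F.Nabk 3
      = nested E' (fun X S T => ker27 (L X) (L S) (L T)) + nested E' (fun X S T => rowW3 (L X) * kk (F.lab S) (F.lab T)) := by
    rw [F.club_eq_sum_parts, sum_parts_eq_nested_univ (fun X S T => clubKer (F.lab X) (F.lab S) (F.lab T)), huniv]
    exact hsplit
  linarith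

end Sunflower

end Summit.CriticalPhenomena.PercolationContinuityZ3.Theorems.SunflowerPartition
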